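import Mathlib
import Literature.MathematicalPhysics.StatisticalMechanics.LocalMatchingCompactness
import Summits.AtomisticToContinuum.Crystallization.Theorems.GappedShellCensusFiveFoldRationingRStubFfrCounting

/-!
# Crux `GappedShellCensus.FiveFoldRationingR` (stmt-AtomisticToContinuum-18071), line `Sketch` —
# stub `stub_ffrCountingZ` (the counting glue for a ZERO-DENSITY census of five-sites)

Setting: `Y ⊆ ℝ³` all-gapped-twelve at scale `a > 0` (hard core `0.98 a`), non-empty, `3a`-relatively
dense.  `F` is the set of five-sites (sites carrying a bond with `≥ 5` common partners), and the
census hypothesis says that `F` has zero density along some sequence of balls: for every `ε > 0` and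
every `r₀` there is a closed ball `B̄(p, r)` with `r ≥ r₀` and `ncard (F ∩ B̄(p, r)) ≤ ε · (r / a)³`.
Conclusion: for every `R` some site `c` has no five-site bond starting within `R` of it.

Proof (by contradiction, the 3-D analogue of `stub_ffrCounting`).  If every site had a five-site
within `R`, then `R ≥ 0` and, by relative denseness, every POINT of space has a five-site within
`ρ := R + 3a`.  Apply the census with `ε := (a / (20ρ))³` and `r₀ := 20ρ` to get a ball `B̄(p, r)`,
`r ≥ 20ρ`, and put `n := ⌊r / (10ρ)⌋₊`, so that `10ρ n ≤ r < 20ρ n`.  The spatial grid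
`p + (3ρ i) e₀ + (3ρ j) e₁ + (3ρ k) e₂`, `i, j, k < n`, for an orthonormal triple `e₀, e₁, e₂` has
distinct points `≥ 3ρ` apart, so the five-sites chosen within `ρ` of them are pairwise distinct, and
they all lie in `B̄(p, r)`.  The hard core makes `F ∩ B̄(p, r)` finite, so `n³ ≤ ε (r / a)³ =
(r / (20ρ))³ < n³`, a contradiction.
-/

noncomputable section

namespace Summit.AtomisticToContinuum.Crystallization.Theorems

open Literature.MathematicalPhysics.StatisticalMechanics

/-- An orthonormal triple of vectors in `ℝ³` (the standard basis). -/
theorem ffrCountZ_exists_orthoTriple :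
    ∃ e₀ e₁ e₂ : EuclideanSpace ℝ (Fin 3), ‖e₀‖ = 1 ∧ ‖e₁‖ = 1 ∧ ‖e₂‖ = 1 ∧
      inner ℝ e₀ e₁ = 0 ∧ inner ℝ e₀ e₂ = 0 ∧ inner ℝ e₁ e₂ = 0 :=
  let b := EuclideanSpace.basisFun (Fin 3) ℝ
  ⟨b 0, b 1, b 2, b.orthonormal.1 0, b.orthonormal.1 1, b.orthonormal.1 2,
    b.orthonormal.2 (show (0 : Fin 3) ≠ 1 by decide),
    b.orthonormal.2 (show (0 : Fin 3) ≠ 2 by decide),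
    b.orthonormal.2 (show (1 : Fin 3) ≠ 2 by decide)⟩

/-- Pythagoras for an orthonormal triple: `‖s e₀ + t e₁ + u e₂‖² = s² + t² + u²`. -/
theorem ffrCountZ_norm_sq_combo {e₀ e₁ e₂ : EuclideanSpace ℝ (Fin 3)} (h0 : ‖e₀‖ = 1)
    (h1 : ‖e₁‖ = 1) (h2 : ‖e₂‖ = 1) (h01 : inner ℝ e₀ e₁ = 0) (h02 : inner ℝ e₀ e₂ = 0)
    (h12 : inner ℝ e₁ e₂ = 0) (s t u : ℝ) :
    ‖s • e₀ + t • e₁ + u • e₂‖ ^ 2 = s ^ 2 + t ^ 2 + u ^ 2 := by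
  rw [norm_add_sq_real, ffrCount_norm_sq_combo h0 h1 h01, inner_add_left, real_inner_smul_left,
    real_inner_smul_left, real_inner_smul_right, real_inner_smul_right, h02, h12, norm_smul, h2,
    Real.norm_eq_abs]
  simp only [mul_one, mul_zero, add_zero, sq_abs]

/-- Triangle bound for a non-negative combination of an orthonormal (unit) triple. -/
theorem ffrCountZ_norm_combo_le {e₀ e₁ e₂ : EuclideanSpace ℝ (Fin 3)} (h0 : ‖e₀‖ = 1)
    (h1 : ‖e₁‖ = 1) (h2 : ‖e₂‖ = 1) {s t u : ℝ} (hs : 0 ≤ s) (ht : 0 ≤ t) (hu : 0 ≤ u) :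
    ‖s • e₀ + t • e₁ + u • e₂‖ ≤ s + t + u := by
  calc ‖s • e₀ + t • e₁ + u • e₂‖ ≤ ‖s • e₀ + t • e₁‖ + ‖u • e₂‖ := norm_add_le _ _
    _ ≤ (s + t) + u := by
      refine add_le_add (ffrCount_norm_combo_le h0 h1 hs ht) (le_of_eq ?_)
      rw [norm_smul, h2, Real.norm_eq_abs, abs_of_nonneg hu, mul_one]

/-- Grid separation in space: distinct points of the grid `p + (L i) e₀ + (L j) e₁ + (L k) e₂`
(`e₀, e₁, e₂` orthonormal) are at distance `≥ L` (trivially so when `L < 0`). -/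
theorem ffrCountZ_grid_sep {e₀ e₁ e₂ : EuclideanSpace ℝ (Fin 3)} (h0 : ‖e₀‖ = 1) (h1 : ‖e₁‖ = 1)
    (h2 : ‖e₂‖ = 1) (h01 : inner ℝ e₀ e₁ = 0) (h02 : inner ℝ e₀ e₂ = 0) (h12 : inner ℝ e₁ e₂ = 0)
    (p : EuclideanSpace ℝ (Fin 3)) (L : ℝ) {u v : ℕ × ℕ × ℕ} (huv : u ≠ v) :
    L ≤ dist (p + ((L * u.1) • e₀ + (L * u.2.1) • e₁ + (L * u.2.2) • e₂))
      (p + ((L * v.1) • e₀ + (L * v.2.1) • e₁ + (L * v.2.2) • e₂)) := by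
  have hint : (1 : ℝ) ≤
      ((u.1 : ℝ) - v.1) ^ 2 + ((u.2.1 : ℝ) - v.2.1) ^ 2 + ((u.2.2 : ℝ) - v.2.2) ^ 2 := by
    by_cases h : u.1 = v.1
    · have h' : u.2 ≠ v.2 := fun h' => huv (Prod.ext h h')
      by_cases h21 : u.2.1 = v.2.1
      · have h22 : u.2.2 ≠ v.2.2 := fun h22 => h' (Prod.ext h21 h22)
        nlinarith [ffrCount_one_le_sq_sub h22, sq_nonneg ((u.1 : ℝ) - v.1),
          sq_nonneg ((u.2.1 : ℝ) - v.2.1)]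
      · nlinarith [ffrCount_one_le_sq_sub h21, sq_nonneg ((u.1 : ℝ) - v.1),
          sq_nonneg ((u.2.2 : ℝ) - v.2.2)]
    · nlinarith [ffrCount_one_le_sq_sub h, sq_nonneg ((u.2.1 : ℝ) - v.2.1),
        sq_nonneg ((u.2.2 : ℝ) - v.2.2)]
  rw [dist_eq_norm, add_sub_add_left_eq_sub]
  have hdiff : ((L * u.1) • e₀ + (L * u.2.1) • e₁ + (L * u.2.2) • e₂)
      - ((L * v.1) • e₀ + (L * v.2.1) • e₁ + (L * v.2.2) • e₂)
      = (L * ((u.1 : ℝ) - v.1)) • e₀ + (L * ((u.2.1 : ℝ) - v.2.1)) • e₁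
        + (L * ((u.2.2 : ℝ) - v.2.2)) • e₂ := by
    simp only [mul_sub, sub_smul]
    abel
  rw [hdiff]
  have hsq : L ^ 2 ≤ ‖(L * ((u.1 : ℝ) - v.1)) • e₀ + (L * ((u.2.1 : ℝ) - v.2.1)) • e₁
      + (L * ((u.2.2 : ℝ) - v.2.2)) • e₂‖ ^ 2 := by
    rw [ffrCountZ_norm_sq_combo h0 h1 h2 h01 h02 h12]
    nlinarith [sq_nonneg L]
  exact le_of_sq_le_sq hsq (norm_nonneg _)

/-- Core counting contradiction: a set `F ⊆ ℝ³` meeting every closed ball in a finite set and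
`ρ`-dense in space (`ρ ≥ a > 0`) admits no zero-density census (for every `ε > 0` and `r₀` a ball
`B̄(p, r)`, `r ≥ r₀`, with `ncard (F ∩ B̄(p, r)) ≤ ε · (r / a)³`): with `ε := (a / (20ρ))³`,
`r₀ := 20ρ` and `n := ⌊r / (10ρ)⌋₊`, a spatial grid of mesh `3ρ` and side `n` based at `p` yields
`n³` distinct members of `F` in `B̄(p, r)`, whereas `ε · (r / a)³ = (r / (20ρ))³ < n³`. -/
theorem ffrCountZ_core {F : Set (EuclideanSpace ℝ (Fin 3))} {a ρ : ℝ} (ha : 0 < a) (hρ : a ≤ ρ)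
    (hfin : ∀ (p : EuclideanSpace ℝ (Fin 3)) (r : ℝ), (F ∩ Metric.closedBall p r).Finite)
    (hcov : ∀ x : EuclideanSpace ℝ (Fin 3), ∃ f ∈ F, dist x f ≤ ρ)
    (hcen : ∀ ε : ℝ, 0 < ε → ∀ r₀ : ℝ, ∃ (p : EuclideanSpace ℝ (Fin 3)) (r : ℝ), r₀ ≤ r ∧
      ((F ∩ Metric.closedBall p r).ncard : ℝ) ≤ ε * (r / a) ^ 3) :
    False := by
  obtain ⟨e₀, e₁, e₂, h0, h1, h2, h01, h02, h12⟩ := ffrCountZ_exists_orthoTriple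
  have hρ0 : 0 < ρ := lt_of_lt_of_le ha hρ
  choose φ hφF hφd using hcov
  -- the census ball
  obtain ⟨p, r, hr, hcen'⟩ := hcen ((a / (20 * ρ)) ^ 3) (by positivity) (20 * ρ)
  have hr0 : 0 < r := by linarith
  -- the side of the grid
  obtain ⟨n, hn⟩ : ∃ n : ℕ, n = ⌊r / (10 * ρ)⌋₊ := ⟨_, rfl⟩
  have hnle : (n : ℝ) ≤ r / (10 * ρ) := by
    rw [hn]
    exact Nat.floor_le (by positivity)
  have hnlt : r / (10 * ρ) < n + 1 := by
    rw [hn]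
    exact Nat.lt_floor_add_one _
  rw [le_div_iff₀ (by positivity)] at hnle
  rw [div_lt_iff₀ (by positivity)] at hnlt
  have hlow : r / (20 * ρ) < n := by
    rw [div_lt_iff₀ (by positivity)]
    linarith
  have hn1 : (1 : ℝ) ≤ n := by
    refine le_trans ?_ hlow.le
    rw [le_div_iff₀ (by positivity)]
    linarith
  -- the grid
  obtain ⟨g, hg⟩ : ∃ g : ℕ × ℕ × ℕ → EuclideanSpace ℝ (Fin 3), ∀ ijk, g ijk =
      p + ((3 * ρ * ijk.1) • e₀ + (3 * ρ * ijk.2.1) • e₁ + (3 * ρ * ijk.2.2) • e₂) :=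
    ⟨_, fun _ => rfl⟩
  -- grid points followed by their five-sites are pairwise distinct
  have hinj : Set.InjOn (fun ijk => φ (g ijk))
      ((Finset.range n ×ˢ Finset.range n ×ˢ Finset.range n : Finset (ℕ × ℕ × ℕ)) :
        Set (ℕ × ℕ × ℕ)) := by
    intro u _ v _ huv
    have huv' : φ (g u) = φ (g v) := huv
    by_contra hne
    have hsep := ffrCountZ_grid_sep h0 h1 h2 h01 h02 h12 p (3 * ρ) hne
    rw [← hg, ← hg] at hsep
    have : dist (g u) (g v) ≤ 2 * ρ :=
      calc dist (g u) (g v) ≤ dist (g u) (φ (g u)) + dist (φ (g u)) (g v) := dist_triangle _ _ _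
        _ ≤ ρ + ρ := by
          gcongr
          · exact hφd (g u)
          · rw [huv', dist_comm]
            exact hφd (g v)
        _ = 2 * ρ := by ring
    linarith
  -- and they lie in the census ball `B̄(p, r)`
  have hmem : ∀ ijk ∈ ((Finset.range n ×ˢ Finset.range n ×ˢ Finset.range n :
      Finset (ℕ × ℕ × ℕ)) : Set (ℕ × ℕ × ℕ)),
      (fun ijk => φ (g ijk)) ijk ∈ F ∩ Metric.closedBall p r := by
    intro ijk hijk
    rw [Finset.mem_coe, Finset.mem_product, Finset.mem_product, Finset.mem_range, Finset.mem_range,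
      Finset.mem_range] at hijk
    refine ⟨hφF _, ?_⟩
    rw [Metric.mem_closedBall]
    have hi : (ijk.1 : ℝ) ≤ n := by exact_mod_cast hijk.1.le
    have hj : (ijk.2.1 : ℝ) ≤ n := by exact_mod_cast hijk.2.1.le
    have hk : (ijk.2.2 : ℝ) ≤ n := by exact_mod_cast hijk.2.2.le
    have hgn : dist (g ijk) p ≤ 3 * ρ * ijk.1 + 3 * ρ * ijk.2.1 + 3 * ρ * ijk.2.2 := by
      rw [hg, dist_eq_norm, add_sub_cancel_left]
      exact ffrCountZ_norm_combo_le h0 h1 h2 (by positivity) (by positivity) (by positivity)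
    have htri : dist (φ (g ijk)) p ≤ dist (φ (g ijk)) (g ijk) + dist (g ijk) p :=
      dist_triangle _ _ _
    rw [dist_comm (φ (g ijk)) (g ijk)] at htri
    have h1' := mul_le_mul_of_nonneg_left hi (by positivity : (0 : ℝ) ≤ 3 * ρ)
    have h2' := mul_le_mul_of_nonneg_left hj (by positivity : (0 : ℝ) ≤ 3 * ρ)
    have h3' := mul_le_mul_of_nonneg_left hk (by positivity : (0 : ℝ) ≤ 3 * ρ)
    have h4' : ρ ≤ ρ * n := le_mul_of_one_le_right hρ0.le hn1
    linarith [hφd (g ijk)]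
  -- count
  have hle : ((Finset.range n ×ˢ Finset.range n ×ˢ Finset.range n : Finset (ℕ × ℕ × ℕ)) :
      Set (ℕ × ℕ × ℕ)).ncard ≤ (F ∩ Metric.closedBall p r).ncard :=
    Set.ncard_le_ncard_of_injOn _ hmem hinj (hfin _ _)
  rw [Set.ncard_coe_finset, Finset.card_product, Finset.card_product, Finset.card_range] at hle
  have hcast : ((n * (n * n) : ℕ) : ℝ) ≤ ((F ∩ Metric.closedBall p r).ncard : ℝ) := by
    exact_mod_cast hle
  push_cast at hcast
  have hε : (a / (20 * ρ)) ^ 3 * (r / a) ^ 3 = (r / (20 * ρ)) ^ 3 := by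
    rw [← mul_pow]
    congr 1
    field_simp
  have hpow : (r / (20 * ρ)) ^ 3 < (n : ℝ) ^ 3 := pow_lt_pow_left₀ hlow (by positivity) (by norm_num)
  have hcube : (n : ℝ) ^ 3 = n * (n * n) := by ring
  linarith

/-- **Stub (counting glue for the zero-density census).** In an all-gapped-twelve configuration that
is `3a`-relatively dense and whose five-sites (sites carrying a bond with `≥ 5` common partners) have
zero density along some sequence of balls (`∀ ε > 0, ∀ r₀, ∃ p r, r₀ ≤ r ∧ #(F ∩ B̄(p, r)) ≤ ε (r/a)³`),
for every `R` some site `c` has no five-site bond starting within `R` of it: otherwise every point of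
space is within `R + 3a` of a five-site and a spatial grid produces `≳ (r / ρ)³` five-sites in every
large ball `B̄(p, r)`, against the census. -/
theorem stub_ffrCountingZ :
    ∀ (Y : Set (EuclideanSpace ℝ (Fin 3))) (a : ℝ), 0 < a → Y.Nonempty →
      (∀ y ∈ Y, ({w ∈ Y | w ≠ y ∧ dist y w ≤ a * (1 + 1 / 50)}.ncard = 12 ∧
        ∀ w ∈ Y, w ≠ y → a * (1 - 1 / 50) ≤ dist y w ∧
          (dist y w ≤ a * (1 + 1 / 50) ∨ a * (63 / 50) ≤ dist y w))) →
      (∀ p : EuclideanSpace ℝ (Fin 3), ∃ y ∈ Y, dist p y ≤ 3 * a) →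
      (∀ ε : ℝ, 0 < ε → ∀ r₀ : ℝ, ∃ (p : EuclideanSpace ℝ (Fin 3)) (r : ℝ), r₀ ≤ r ∧
        (({y ∈ Y | ∃ v ∈ Y, v ≠ y ∧ dist y v ≤ a * (1 + 1 / 50) ∧
            5 ≤ {w ∈ Y | w ≠ y ∧ w ≠ v ∧ dist y w ≤ a * (1 + 1 / 50) ∧
              dist v w ≤ a * (1 + 1 / 50)}.ncard} ∩ Metric.closedBall p r).ncard : ℝ) ≤ ε * (r / a) ^ 3) →
      ∀ R : ℝ, ∃ c ∈ Y, ∀ y ∈ Y, dist y c ≤ R → ∀ v ∈ Y, v ≠ y → dist y v ≤ a * (1 + 1 / 50) →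
        {w ∈ Y | w ≠ y ∧ w ≠ v ∧ dist y w ≤ a * (1 + 1 / 50) ∧ dist v w ≤ a * (1 + 1 / 50)}.ncard ≤ 4 := by
  intro Y a ha hne hgap hRD hC R
  by_contra h
  push Not at h
  -- `h`: every site has a five-site within `R`; with `Y` non-empty this forces `0 ≤ R`
  have hR0 : 0 ≤ R := by
    obtain ⟨c, hc⟩ := hne
    obtain ⟨y, -, hyc, -⟩ := h c hc
    exact dist_nonneg.trans hyc
  refine ffrCountZ_core (ρ := R + 3 * a) ha (by linarith) ?_ ?_ hC
  · -- hard core: five-sites in a ball form a finite set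
    intro p r
    refine finite_of_forall_le_dist_of_subset_closedBall (δ := a * (1 - 1 / 50)) (by positivity) ?_
      Set.inter_subset_right
    rintro u ⟨⟨huY, -⟩, -⟩ w ⟨⟨hwY, -⟩, -⟩ huw
    exact ((hgap u huY).2 w hwY (Ne.symm huw)).1
  · -- relative denseness: every point of space has a five-site within `R + 3a`
    intro x
    obtain ⟨y, hyY, hxy⟩ := hRD x
    obtain ⟨y', hy'Y, hy'y, v, hvY, hvy', hdy'v, hcnt⟩ := h y hyY
    refine ⟨y', ⟨hy'Y, v, hvY, hvy', hdy'v, Nat.succ_le_of_lt hcnt⟩, ?_⟩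
    calc dist x y' ≤ dist x y + dist y y' := dist_triangle _ _ _
      _ ≤ 3 * a + R := add_le_add hxy (by rw [dist_comm]; exact hy'y)
      _ = R + 3 * a := by ring

end Summit.AtomisticToContinuum.Crystallization.Theorems

end
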